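import Summits.ResolutionOfSingularities.ResolutionOfSingularities.Theorems.WildDescent10
import HarnessLib

/-!
# WildDescent (11/13) — β-descent in a linear frame; §8 Chain/Step part 2: `minSnd_image_psi`, L4+L6 `step_laws`

Verbatim slice of the farm-checked monolith `WildDescent.lean` of cell `decomp-res`, seat `decomp-res-lens-5`, g36
(sha256 4ec0fa6f4f9efba7…); one namespace `Summit.ResolutionOfSingularities.ResolutionOfSingularities.Theorems.WildDescent` across the
slices, imports chained (laws L1–L7 and the mechanism: module docstring of slice 1; main theorems: slice 13/13).
-/

open MvPolynomial Finset
open scoped BigOperators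
open Literature.AlgebraicGeometry.Resolution
open Literature.AlgebraicGeometry.Resolution.Hauser2010
open Literature.AlgebraicGeometry.Resolution.PointBlowup
open Literature.AlgebraicGeometry.Resolution.HauserPerlega2024

namespace Summit.ResolutionOfSingularities.ResolutionOfSingularities.Theorems.WildDescent

section Chain

variable {K : Type} [Field K]

variable {s : ℕ} {G : ℕ → MvPolynomial (Fin 3) K} {j : ℕ → Fin 3} {b : ℕ → Fin 3 → K} {k l f : ℕ → Fin 3} {c : ℕ → K}
  {ℓ : ℕ → MvPolynomial (Fin 3) K}

section Step

variable (hs : s ≠ 0) (hkl : ∀ n, k n ≠ l n) (hfk : ∀ n, f n ≠ k n) (hfl : ∀ n, f n ≠ l n)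
  (hrec : ∀ n, G (n + 1) = PointBlowup.translate (b n) (chartTransform s (j n) (G n)))
  (hordG : ∀ n, ordZero (G n) = s) (hc : ∀ n, c n ≠ 0) (hℓ : ∀ n, (ℓ n).IsHomogeneous 1)
  (hin : ∀ n, homogeneousComponent s (G n) = C (c n) * ℓ n ^ s)
  (htr : ∀ n, coeff (Finsupp.single (f n) 1) (ℓ n) ≠ 0) (hiso : ∀ n, NearCut.IsolatedMult s (G n))
  (hmove : ∀ n, j n = l n ∨ j n = f n) (hb : ∀ n i, i ≠ f (n + 1) → b n i = 0)
  (hwalls : ∀ n, (k (n + 1) = k n ∧ l (n + 1) = j n) ∨ (k (n + 1) = j n ∧ l (n + 1) = k n))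

/-- `Ψ` preserves ordinates, hence the least ordinate: `minSnd (Ψ S) = minSnd S`. [folklore] -/
theorem minSnd_image_psi {S : Finset (ℚ × ℚ)} (h : S.Nonempty) : minSnd (S.image psi) = minSnd S := by
  apply le_antisymm
  · obtain ⟨x, hx, hxe⟩ := exists_snd_eq_minSnd h
    rw [← hxe]
    exact minSnd_le (x := psi x) (Finset.mem_image_of_mem _ hx)
  · refine le_minSnd (h.image _) fun y hy => ?_
    obtain ⟨x, hx, rfl⟩ := Finset.mem_image.mp hy
    rw [psi_snd]
    exact minSnd_le hx

include hs hkl hfk hfl hrec hordG hc hℓ hin htr hiso hmove hb hwalls in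
/-- **L4 + L6 · THE STEP LAWS.**  (ENTRY) after a move losing the wall in slot 2 (a `Φ`-move) every point of `Δ_{n+1}` has
second coordinate `> 0`, after a `Ψ`-move first coordinate `> 0`.  (EXACT TRANSPORT) if moreover `α_n > 0` at a `Φ`-move
(resp. `ε_n > 0` at a `Ψ`-move) then the next tangent form has no component along the new wall (RE-PREPARATION TEST), the
next frame polynomial IS the transported one, and `(α, β)_{n+1} = Φ(α_n, β_n)` (resp. `β_{n+1} ≤ β_n`, `ε_{n+1} ≥ ε_n`).
[cite: CossartJannsenSaito2020, Lemmas 11.1/11.2 p.129, Lemma 12.1 p.132; new: uniform in `p`] -/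
theorem step_laws (n : ℕ) :
    (∀ x ∈ framePts s G ℓ f k l j (n + 1),
        ((slots (k 0) (l 0) l j n).2 = l n → 0 < x.2) ∧ ((slots (k 0) (l 0) l j n).1 = l n → 0 < x.1)) ∧
    ((((slots (k 0) (l 0) l j n).2 = l n → 0 < (lexMin (framePts s G ℓ f k l j n)).1) ∧
        ((slots (k 0) (l 0) l j n).1 = l n → 0 < minSnd (framePts s G ℓ f k l j n))) →
      ((slots (k 0) (l 0) l j n).2 = l n →
          lexMin (framePts s G ℓ f k l j (n + 1)) = phi (lexMin (framePts s G ℓ f k l j n))) ∧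
      ((slots (k 0) (l 0) l j n).1 = l n →
          (lexMin (framePts s G ℓ f k l j (n + 1))).2 ≤ (lexMin (framePts s G ℓ f k l j n)).2 ∧
            minSnd (framePts s G ℓ f k l j n) ≤ minSnd (framePts s G ℓ f k l j (n + 1)))) := by
  classical
  obtain ⟨Hn, μ, hHn, hdom, hmin⟩ := transported hs hkl hfk hfl hrec hordG hc hℓ hin htr hmove hb hwalls n
  have hinH := frameH_in hkl hfk hfl hℓ hin htr n
  have hordH := frameH_ord hfk hfl hordG (ℓ := ℓ) (k := k) (l := l) n
  have hslots := slots_spec hkl hwalls (j := j) n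
  have hSne := framePts_nonempty hkl hfk hfl hiso hwalls (s := s) (G := G) (ℓ := ℓ) n
  have hSne' := framePts_nonempty hkl hfk hfl hiso hwalls (s := s) (G := G) (ℓ := ℓ) (n + 1)
  -- letters of the next stage
  have hzk : f (n + 1) ≠ k n := by
    rcases hwalls n with ⟨hk', _⟩ | ⟨_, hl'⟩
    · exact hk' ▸ hfk (n + 1)
    · exact hl' ▸ hfl (n + 1)
  have hzE : f (n + 1) ≠ j n := by
    rcases hwalls n with ⟨_, hl'⟩ | ⟨hk', _⟩
    · exact hl' ▸ hfl (n + 1)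
    · exact hk' ▸ hfk (n + 1)
  have hkE : k n ≠ j n := by
    rcases hmove n with hj | hj
    · rw [hj]; exact hkl n
    · rw [hj]; exact (hfk n).symm
  -- tangent data of the transported frame
  set κ' := coeff (Finsupp.single (f (n + 1)) 1) (ℓ (n + 1)) with hκ'
  have hinT := in_transport hzk hzE hkE (hin (n + 1)) (hℓ (n + 1)) μ
  rw [← hHn] at hinT
  have hL := lin_transport_isHomogeneous (hℓ (n + 1)) κ' μ (k := k n)
  -- the frame polynomial of stage `n+1` in terms of `H^new`
  have hframe_raw : frameH G ℓ f k l (n + 1) = WallFrames.zshear (f (n + 1))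
      (-(C (coeff (Finsupp.single (k n) 1) (ℓ (n + 1)) / κ') * X (k n) +
         C (coeff (Finsupp.single (j n) 1) (ℓ (n + 1)) / κ') * X (j n))) (G (n + 1)) := by
    unfold frameH
    rcases hwalls n with ⟨hk', hl'⟩ | ⟨hk', hl'⟩
    · rw [hk', hl']
    · rw [hk', hl', add_comm (C _ * X (j n))]
  -- slots of stage `n+1`, the image set `Y`, and its position
  rcases hslots with ⟨hu, hv⟩ | ⟨hu, hv⟩
  · -- the lost wall `l n` sat in slot 2: a `Φ`-move; new slots `(k n, j n)`
    have hsl : slots (k 0) (l 0) l j (n + 1) = (k n, j n) := by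
      rw [slots_succ, if_neg (by rw [hu]; exact hkl n), hu]
    have hY : framePtsT s G ℓ f k l j n = (framePts s G ℓ f k l j n).image phi := by
      unfold framePtsT; rw [if_pos hv]
    rw [hsl, hY] at hdom hmin
    simp only at hdom hmin
    have hslot' : (k n = k n ∧ j n = j n) ∨ (k n = j n ∧ j n = k n) := Or.inl ⟨rfl, rfl⟩
    have hYpos : ∀ y ∈ (framePts s G ℓ f k l j n).image phi, (j n = j n → 0 < y.2) ∧ (k n = j n → 0 < y.1) := by
      intro y hy
      obtain ⟨x, hx, rfl⟩ := Finset.mem_image.mp hy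
      refine ⟨fun _ => ?_, fun h => absurd h hkE⟩
      unfold framePts at hx
      rw [hu, hv] at hx
      have := one_lt_add_of_mem_pts (hfk n) (hfl n) (hkl n) (fin3_exhaust (hfk n) (hfl n) (hkl n)) hinH hordH.symm.le hx
      simp only [phi_snd]; linarith
    have hpos := posE_of_dom hslot' hdom hYpos
    have hk0 := reprep_k hzk hkE hs hpos hinT hL (hc (n + 1))
    rw [coeff_lin_transport_k] at hk0
    have hframe := hframe_raw.trans (next_frame_eq (E := j n) hzk hHn (htr (n + 1)) hk0)
    refine ⟨?_, ?_⟩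
    · -- ENTRY
      intro x hx
      refine ⟨fun _ => ?_, fun h => absurd h (by rw [hu]; exact hkl n)⟩
      have hposF := posE_zshear hpos (-(coeff (Finsupp.single (j n) 1) (ℓ (n + 1)) / κ'))
      rw [map_neg, neg_mul, ← hframe] at hposF
      unfold framePts at hx
      rw [hsl] at hx
      exact ((pos_of_posE hkE hslot' hposF) x hx).1 rfl
    · -- EXACT TRANSPORT
      intro hreg
      refine ⟨fun _ => ?_, fun h => absurd h (by rw [hu]; exact hkl n)⟩
      have hα := hreg.1 hv
      have hE0 : coeff (Finsupp.single (j n) 1) (ℓ (n + 1)) = 0 := by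
        by_contra hE
        have hE' : coeff (Finsupp.single (j n) 1) (ℓ (n + 1) + C κ' * (-(C μ * X (k n)))) ≠ 0 := by
          rw [coeff_lin_transport_of_ne (Ne.symm hkE)]; exact hE
        obtain ⟨y, hy, hy1, _⟩ := reprep_E hzE hkE hs hdom hinT hL (hc (n + 1)) hE'
        obtain ⟨x, hx, rfl⟩ := Finset.mem_image.mp hy
        have h1 := hy1 rfl
        unfold framePts at hx hα
        have := lexMin_fst_le hx
        simp only [phi_fst] at h1
        linarith
      have hframe' := hframe_raw.trans (next_frame_eq' (E := j n) hzk hHn (htr (n + 1)) hk0 hE0)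
      have hne : ((framePts s G ℓ f k l j n).image phi).Nonempty := hSne.image _
      have hmem := hmin _ (lexMin_mem hne) fun z hz h1 h2 => eq_lexMin_of_le hz h1 h2
      have hdom' : ∀ e ∈ framePts s G ℓ f k l j (n + 1), ∃ y ∈ (framePts s G ℓ f k l j n).image phi,
          y.1 ≤ e.1 ∧ y.2 ≤ e.2 := by
        intro e he; unfold framePts at he; rw [hsl, hframe'] at he; exact hdom e he
      have hmem' : lexMin ((framePts s G ℓ f k l j n).image phi) ∈ framePts s G ℓ f k l j (n + 1) := by
        unfold framePts; rw [hsl, hframe']; exact hmem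
      rw [lexMin_of_upper hdom' hmem', lexMin_image_phi hSne]
  · -- the lost wall `l n` sat in slot 1: a `Ψ`-move; new slots `(j n, k n)`
    have hsl : slots (k 0) (l 0) l j (n + 1) = (j n, k n) := by
      rw [slots_succ, if_pos hu, hv]
    have hY : framePtsT s G ℓ f k l j n = (framePts s G ℓ f k l j n).image psi := by
      unfold framePtsT; rw [if_neg (by rw [hv]; exact hkl n)]
    rw [hsl, hY] at hdom hmin
    simp only at hdom hmin
    have hslot' : (j n = k n ∧ k n = j n) ∨ (j n = j n ∧ k n = k n) := Or.inr ⟨rfl, rfl⟩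
    have hYpos : ∀ y ∈ (framePts s G ℓ f k l j n).image psi, (k n = j n → 0 < y.2) ∧ (j n = j n → 0 < y.1) := by
      intro y hy
      obtain ⟨x, hx, rfl⟩ := Finset.mem_image.mp hy
      refine ⟨fun h => absurd h hkE, fun _ => ?_⟩
      unfold framePts at hx
      rw [hu, hv] at hx
      have := one_lt_add_of_mem_pts (hfl n) (hfk n) (hkl n).symm (fin3_exhaust (hfl n) (hfk n) (hkl n).symm) hinH
        hordH.symm.le hx
      simp only [psi_fst]; linarith
    have hpos := posE_of_dom hslot' hdom hYpos
    have hk0 := reprep_k hzk hkE hs hpos hinT hL (hc (n + 1))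
    rw [coeff_lin_transport_k] at hk0
    have hframe := hframe_raw.trans (next_frame_eq (E := j n) hzk hHn (htr (n + 1)) hk0)
    refine ⟨?_, ?_⟩
    · -- ENTRY
      intro x hx
      refine ⟨fun h => absurd h (by rw [hv]; exact hkl n), fun _ => ?_⟩
      have hposF := posE_zshear hpos (-(coeff (Finsupp.single (j n) 1) (ℓ (n + 1)) / κ'))
      rw [map_neg, neg_mul, ← hframe] at hposF
      unfold framePts at hx
      rw [hsl] at hx
      exact ((pos_of_posE hkE hslot' hposF) x hx).2 rfl
    · -- EXACT TRANSPORT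
      intro hreg
      refine ⟨fun h => absurd h (by rw [hv]; exact hkl n), fun _ => ?_⟩
      have hε := hreg.2 hu
      have hE0 : coeff (Finsupp.single (j n) 1) (ℓ (n + 1)) = 0 := by
        by_contra hE
        have hE' : coeff (Finsupp.single (j n) 1) (ℓ (n + 1) + C κ' * (-(C μ * X (k n)))) ≠ 0 := by
          rw [coeff_lin_transport_of_ne (Ne.symm hkE)]; exact hE
        obtain ⟨y, hy, _, hy2⟩ := reprep_E hzE hkE hs hdom hinT hL (hc (n + 1)) hE'
        obtain ⟨x, hx, rfl⟩ := Finset.mem_image.mp hy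
        have h2 := hy2 rfl
        unfold framePts at hx hε
        have := minSnd_le hx
        simp only [psi_snd] at h2
        linarith
      have hframe' := hframe_raw.trans (next_frame_eq' (E := j n) hzk hHn (htr (n + 1)) hk0 hE0)
      have hne : ((framePts s G ℓ f k l j n).image psi).Nonempty := hSne.image _
      have hmem := hmin _ (lexMin_mem hne) fun z hz h1 h2 => eq_lexMin_of_le hz h1 h2
      have hdom' : ∀ e ∈ framePts s G ℓ f k l j (n + 1), ∃ y ∈ (framePts s G ℓ f k l j n).image psi,
          y.1 ≤ e.1 ∧ y.2 ≤ e.2 := by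
        intro e he; unfold framePts at he; rw [hsl, hframe'] at he; exact hdom e he
      have hmem' : lexMin ((framePts s G ℓ f k l j n).image psi) ∈ framePts s G ℓ f k l j (n + 1) := by
        unfold framePts; rw [hsl, hframe']; exact hmem
      rw [lexMin_of_upper hdom' hmem']
      refine ⟨lexMin_image_psi_snd_le hSne, ?_⟩
      rw [← minSnd_image_psi hSne]
      exact minSnd_le_of_upper hSne' hdom'

end Step

end Chain

end Summit.ResolutionOfSingularities.ResolutionOfSingularities.Theorems.WildDescent
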